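import Summits.BirchSwinnertonDyer.Rank1Residual.X12.O11.RamifiedEllipticUnitMechanismZpThreeT
import HarnessLib

/-!
# O11 at the ramified prime `p = 3`: the DEFECT-COMPLETE `ℤ₃`-level pair (IMC)₃♮ / (PR|IMC)₃♮ —
# the bottom dictionary of the elliptic-unit index with the LOCAL-KERNEL product `τ(T₀)` and the
# INERT Tamagawa exponent `t_cs` displayed (cell `bsd-print-cfram`, D-0131 (2), typer `ty2` gen 4;
# answer to p2's PRE-SWAP CHECK r6 of 2026-08-27T21:19:59Z; NOTHING about BSD asserted)

HONEST FRAMING (cell `bsd-print-cfram`, HOME `run/shared/lean/pub/bsd-print-cfram/`): no named fact, no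
axiom, no `sorry`; two `ℕ`-valued definitions (displayed terms), TWO `@[conjecture]` summit-side
obligations ((IMC)₃♮, (PR|IMC)₃♮) and theorems; regimes N, V, T and the leaf stay OPEN; beyond-print
theorem: NO.

WHY A NEW PAIR (gen 3's `RamifiedCMEllipticUnitIMCAtZpThreeAll` / `RamifiedCMBottomClassIndexLawAtZpThreeT`,
p570438, stay as they are; nothing is edited in place). By DEFINITION (`HasBottomIndexExpZp`)
`3^c = [A : A_tors + 𝒪_𝔭 · z(𝟙)]`, `A = H¹(G_Σ(K), T₃W_K)` (relaxed at `𝔭`; the Kummer condition at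
`v ∤ 3` is vacuous for the Tate module), `A_tors = W(K)[3^∞]` (order `d₀`), `z(𝟙)` a universal norm.
Poitou–Tate for `T₃W_K` along `K^ac_n` (every local term at `𝔭` and at a finitely decomposed place is
FINITE — `W(K^ac_{∞,𝔭})[3^∞]` is finite since `ψ_E(G_{K_𝔭})` is open in `𝒪_𝔭^×`), `S^Γ = H⁰(K,T) = 0`,
Greenberg's Lemma 4.2 on `S/Λ_𝒪 z^ac` and `A_tors ∩ 𝒪_𝔭 z(𝟙) = 0` give, at EVERY `3`-frame, for every
admissible `T₀` and every `Λ`-level identity `char_Λ(S^ac_rel/Λ_𝒪 z^ac) = (g)`, `g(0) ≠ 0`: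
  (D′) `c + log₃ d₀ + log₃ d(T₀) = ord₃ g(0) + log₃ #X[T] + log₃ τ(T₀)`,  `τ(T₀) := #ker r_𝔭 · ∏_{v∈T₀} #ker r_v`
— p2's `κ_rel = #coker(S_Γ ↪ A) = #X[T] · τ(T₀)/d(T₀)`, the SLACK of the proved control bound
`d(T₀) ≤ #ker r_𝔭 · 3^{Σ ord₃ c_v}` (companion VII), NOT `#X[T] · d₀`; so gen 3's «`n₀ + log₃ #X[T] = c`»
holds iff `τ(T₀) · 3^{t_cs} = d₀ · d(T₀)` (fails e.g. on a T_cube frame with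
`W(K^ac_∞)[3^∞] = W(K^ac_{∞,𝔭})[3^∞]` and no finitely-decomposed `3`-Tamagawa: `c = n₀ + log₃ #X[T] − 1`).
Second, `X = XAc (W_K) 3 κ 𝔭 ∅ γ` is the MINIMAL strict dual (locally trivial at every `w ∤ 3`); at a bad
place `v` of `W_K` INERT over `ℚ` (`ℓ = 2` or `ℓ ≡ 2 (mod 3)`, split completely in `K^ac_∞`) the term
`H²_Iw,v ≅ Λ ⊗ W(K_v)^∨` has `μ = ord₃ c_v(W_K)` (`= 1` exactly at Kodaira type IV / IV*, tree
`AdditivePotMult/QuadraticBaseChangeTamagawaTypeIVInert`), so `char H²_Iw = char X_min · 3^{t_cs}` = `char`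
of the GREENBERG dual — Pollack–Weston's dichotomy. The BSD-consistent identity at `3` is the Greenberg one
(`ord₃ g(0) = n₀ + t_cs`): with (D′), control and the strict-Selmer index theorems it makes
`3^c · #W(K)[3^∞]² = 3^{ñ+ñ'} #Ш(W)#Ш(W') · #ker r_𝔭 · ∏_{ALL bad v ∤ 3} c_v(W_K)^{(3)}` — EVERY Tamagawa
number, as the explicit reciprocity law and `BSD₃(W)`, `BSD₃(W')` force (the minimal form would blind `c`
to the inert ones only). At `p ≥ 5` `t_cs ≡ 0` (CM Tamagawa numbers `≤ 4`): [BKNO]'s printed minimal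
`X_str` is consistent there, not at `3` (census kit j291137: `t_cs ≥ 1` on 44/100 window classes, N 17/45,
T 27/55).

* §0 `inertTamagawaProductThree W K` (`∏ᶠ` over the places `v ∤ 3` of inertia degree `2` of
  `c_v(W_K)`; `t_cs` = its `ord₃`), `localKernelProductAtThree W K 𝔭 κ T₀` (`τ(T₀)`); unfolding lemmas;
  `τ(∅) = 1` under `W_K(K_𝔭)[3] = 0`.
* §1 `@[conjecture]` (IMC)₃♮ `RamifiedCMEllipticUnitIMCAtZpThreeGr W` — regime-free (binders: frame,
  `r_an = 1`, `κ`, `γ`; inside: local finiteness, admissible `T₀`): SOME pinned datum has an exponent `c`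
  with «`c + log₃ d₀ + log₃ d(T₀) = n₀ + log₃ #X[T] + log₃ τ(T₀) + t_cs`»; and (PR|IMC)₃♮
  `RamifiedCMBottomClassIndexLawAtZpThreeGr W` — binders of (R-EU)₃ᵀ verbatim, relative to the (IMC)₃♮
  identity: «`c + 2 log₃ d₀ = ñ + ñ' + ord₃ q + ord₃ q' + log₃ τ(T₀) + t_cs`». Nothing asserted.
* §2 PROVED seams: the ♮ pair ⟹ (R-EU)₃ᵀ (subtract: `τ(T₀)` and `t_cs` cancel); (R-EU)₃ᵀ ∧ (R-tors)₃ᵀ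
  ⟹ (PR|IMC)₃♮ (hence ⟸ GZK); the `↔`.
* §3 PROVED consumer: `BSDp W 3` at any analytic-rank-one `3`-frame from the ♮ pair + local finiteness
  + four named facts; class-wide form. Route-level edges (T/V/N/C1 by name) and the PROVED relation to
  gen 1's regime-N pair (on frames with (A𝔭)₃ and `t_cs = 0` the ♮ pair specialises to p548597's pair, so
  items 21352/21353 are its `t_cs = 0` case) are the companion
  `Rank1Residual/PrintCfram/LocalThreeTorsionZpThreeGr.lean`.

References: [PollackWeston2011] Remark 3.1, Def. 3.3, Lemma 3.4, Prop. 3.7, Thm. 1.1 (arXiv:math/0610694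
pp. 2, 7–8: minimal vs Greenberg Selmer groups in the anticyclotomic tower; Tamagawa exponents at inert
primes); [Harari2020] Thm. 17.13 (Poitou–Tate nine-term sequence); [MilneADT2006] Thm. I.4.10;
[GreenbergLNM1716] §3 Lemmas 3.1–3.4, §4 Lemma 4.2, Prop. 4.13; [Nekovar2006] §8–§9 (Iwasawa-theoretic
duality; shape); [BurungaleKobayashiNakamuraOta2026] §3.1.2, §3.2.2, Prop. 3.7, Thm. 3.14 (claim;
preprint; shape only); [PerrinRiou1993AIF] §3.3.4–3.3.5; [JetchevSkinnerWan2017] Prop. 3.3.7 (shape);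
[Miller2011LMS] Def. 1.1; [Kolyvagin1990] Thm. A; tree: `X12/O11/RamifiedEllipticUnitMechanismZpThree{,V,T}.lean`,
`X12/O11/RamifiedStrictDescentAtThreeRegimeT{,Inputs,Discharge}.lean`, `X11b/LocalKernelTamagawaExact.lean`;
HOME/STATUS.md 2026-08-27 ty2 g4 RULING; seat NOTES.md §g4 (derivation of (D′)).
-/

noncomputable section

open scoped Classical

open WeierstrassCurve NumberField IsDedekindDomain Field PowerSeries
  Literature.NumberTheory.EllipticCurves
  Literature.NumberTheory.EllipticCurves.GreenbergSelmer
  Literature.NumberTheory.EllipticCurves.Rank1Residual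
  Literature.NumberTheory.EllipticCurves.Rank1Residual.Typed
  Literature.NumberTheory.EllipticCurves.BurungaleKobayashiNakamuraOta2026
  Literature.NumberTheory.GaloisRepresentations
  Summit.BirchSwinnertonDyer.Rank1Residual
  Summit.BirchSwinnertonDyer.Rank1Residual.Additive
  Summit.BirchSwinnertonDyer.Rank1Residual.X11b
  Summit.BirchSwinnertonDyer.Rank1Residual.X11b.AcSelmer
  Summit.BirchSwinnertonDyer.BirchSwinnertonDyer.Theorems

namespace Summit.BirchSwinnertonDyer.Rank1Residual.X12.O11

variable (W : WeierstrassCurve ℚ) [W.IsElliptic] [W.IsGloballyMinimal]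

/-! ## §0 The two displayed terms: the inert Tamagawa product and the local-kernel product `τ(T₀)` -/

section Displayed

variable (K : Type) [Field K] [NumberField K]

omit [W.IsElliptic] [W.IsGloballyMinimal] in
/-- **The INERT Tamagawa product `∏_{v ∤ 3, f(v|ℚ) = 2} c_v(W_K)`** of `W_K = W.baseChange K` over the
finite places `v` of `K` away from `3` of inertia degree `2` over `ℚ` (for `K = ℚ(√−3)`: the places above
the rational primes `ℓ = 2` and `ℓ ≡ 2 (mod 3)`, i.e. the places that split completely in the
anticyclotomic `ℤ₃`-extension), as a `finprod` (junk value `1` off finite support; the support is inside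
the bad places). Its `3`-adic valuation `t_cs` is Pollack–Weston's sum of Tamagawa exponents at the primes
inert in `K`: the `μ`-invariant by which the Greenberg (unramified away from `p`) and the minimal
(locally trivial away from `p`) anticyclotomic Selmer groups differ (their Lemma 3.4, Prop. 3.7); for a
`j = 0` curve `ord₃ c_v(W_K) = 1` exactly at an inert place of Kodaira type IV / IV*
(tree `AdditivePotMult/QuadraticBaseChangeTamagawaTypeIVInert`). A displayed term; nothing asserted.
[cite: PollackWeston2011, Def. 3.3, Lemma 3.4 and Prop. 3.7 (arXiv:math/0610694 pp. 7–8) (shape only: printed for weight-two newforms on a definite quaternion algebra; used here for the local algebra at places split completely in an anticyclotomic tower)] -/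
def inertTamagawaProductThree : ℕ :=
  ∏ᶠ v : HeightOneSpectrum (𝓞 K),
    if ((3 : ℕ) : 𝓞 K) ∉ v.asIdeal ∧ v.asIdeal.inertiaDeg (𝓞 ℚ) = 2 then
      ((W.baseChange K).baseChange (v.adicCompletion K)).localTamagawaNumber
        (v.adicCompletionIntegers K)
    else 1

variable {K} (𝔭 : HeightOneSpectrum (𝓞 K)) (κ : ZpExtension K 3)

omit [W.IsElliptic] [W.IsGloballyMinimal] in
/-- **The local-kernel product `τ(T₀) := #ker r_𝔭 · ∏_{v ∈ T₀} #ker r_v`** (Greenberg's local kernels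
`ker(H¹(K_v, W_K[3^∞]) → H¹(K_{∞,η}, W_K[3^∞]))` for the `ℤ₃`-extension `κ`): the UPPER BOUND of the
cell's control inequality `d(T₀) ≤ τ(T₀)` (companion VII
`natCard_invariants_mul_globalDefect_eq_mul_defect_of_isFrameThree`, where the factors at `v ∈ T₀` are
written `3^{ord₃ c_v}` — equal to `#ker r_v` at a finitely decomposed `v ∤ 3`, X11b
`natCard_localKer_eq_pow_padicValNat_localTamagawaNumber`; at a completely split `v`, `ker r_v = 0`). The
Poitou–Tate descent of the bottom index reads the QUOTIENT `τ(T₀)/d(T₀)` (module docstring (D′)). A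
displayed term (`Nat.card`, junk `0` on an infinite kernel — the carriers bind finiteness of `ker r_𝔭`);
nothing asserted. [cite: GreenbergLNM1716, §3 Lemmas 3.1–3.4 (the local kernels `ker r_v`)] -/
def localKernelProductAtThree (T₀ : Finset (HeightOneSpectrum (𝓞 K))) : ℕ :=
  Nat.card (localKer κ.kerSubgroup ((W.baseChange K).geomPrimaryTorsion 3) 𝔭) *
    ∏ v ∈ T₀, Nat.card (localKer κ.kerSubgroup ((W.baseChange K).geomPrimaryTorsion 3) v)

omit [W.IsGloballyMinimal] in
/-- **`τ(∅) = 1` when `W_K(K_𝔭)[3] = 0`** (regimes N ∪ V): then `ker r_𝔭 = 0`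
(`AcSelmer.localKer_eq_bot_of_noPTorsion`). [cite: GreenbergLNM1716, §3 Lemma 3.1 and pp. 74–75] -/
theorem localKernelProductAtThree_empty_eq_one
    (h𝔭 : ∀ R : ((W.baseChange K).baseChange (𝔭.adicCompletion K)).toAffine.Point,
      (3 : ℕ) • R = 0 → R = 0) :
    localKernelProductAtThree W 𝔭 κ ∅ = 1 := by
  haveI : (W.baseChange K).IsElliptic := by rw [baseChange]; infer_instance
  rw [localKernelProductAtThree, Finset.prod_empty, mul_one,
    AcSelmer.localKer_eq_bot_of_noPTorsion (W.baseChange K) 3 κ 𝔭 h𝔭]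
  exact AddSubgroup.card_bot

omit [W.IsGloballyMinimal] in
/-- **`τ(∅) = 1` at a `3`-frame under the `ℚ₃`-binders (A𝔭)₃.**
[cite: GreenbergLNM1716, §3 Lemma 3.1 and pp. 74–75] -/
theorem localKernelProductAtThree_empty_eq_one_of_isFrameThree {W' : WeierstrassCurve ℚ} [W'.IsElliptic]
    {C : VariableChange ℚ} (hF : IsFrameThree W K 𝔭 W' C)
    (htors : ∀ Q : (W.baseChange ℚ_[3]).toAffine.Point, (3 : ℕ) • Q = 0 → Q = 0)
    (htors' : ∀ Q : (W'.baseChange ℚ_[3]).toAffine.Point, (3 : ℕ) • Q = 0 → Q = 0) :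
    localKernelProductAtThree W 𝔭 κ ∅ = 1 :=
  localKernelProductAtThree_empty_eq_one W 𝔭 κ
    (noThreeTorsion_adicCompletion_of_isFrameThree W hF htors htors')

end Displayed

/-! ## §1 The defect-complete carriers (IMC)₃♮ and (PR|IMC)₃♮ (both `@[conjecture]`; nothing asserted) -/

section CarriersGr

/-- **(IMC)₃♮ TYPED (nothing asserted): the elliptic-unit MAIN-CONJECTURE identity at the ramified
prime `3` in analytic rank one, read at `T = 0` with the COMPLETE bottom dictionary.** At every
`3`-framed pair (`K = ℚ(√−3)`, `𝔭 ∋ 3`, `W' = C • W^{(−3)}`) of analytic rank one and every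
anticyclotomic `κ` with topological generator `γ`, SOME pinned datum `(ι, φ, Ω, 𝓔, D)` (`Ω ≠ 0`,
`L(φ, s) = L(W, s)` on `re s > 3/2`) has a bottom index exponent `c` (`D.HasBottomIndexExpZp c`:
`3^c = [S_rel(K) : tors + 𝒪_𝔭 · z(𝟙)]`) such that, granted finiteness of `ker r_𝔭`, for every finite
`T₀` of places `v ∤ 3` with (Av)₃ off `T₀` and every shape `ord₃ f(0) = n₀` of
`X = XAc (W_K) 3 κ 𝔭 ∅ γ` with `X[T]` finite:
  `c + log₃ d₀ + log₃ d(T₀) = n₀ + log₃ #X[T] + log₃ τ(T₀) + t_cs`,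
`d₀ = globalControlDefectAtThree W K κ`, `d(T₀) = controlDefectAtThree W K 𝔭 κ T₀`,
`τ(T₀) = localKernelProductAtThree W 𝔭 κ T₀`, `t_cs = ord₃ (inertTamagawaProductThree W K)`. This is
(D′) of the module docstring with `ord₃ g(0) = n₀ + t_cs`, i.e. the `Λ`-level identity
«`char_Λ(S^ac_rel/Λ_𝒪 z^ac) = char_Λ(X_min) · 3^{t_cs}`» (= `char` of the GREENBERG strict dual) read at
the trivial character through Poitou–Tate; the gen-3 carrier `RamifiedCMEllipticUnitIMCAtZpThreeAll`
(p570438) is the reading with `τ(T₀) · 3^{t_cs}` replaced by `d₀ · d(T₀)`, correct only where these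
agree. PRINT STATUS: the `Λ`-level identity at `p ≥ 5` (where `t_cs = 0`) is [BKNO] Thm. 3.14 (3) /
Prop. 3.7 (PRE); at `3` nothing is printed ([BKNO] Thm. 3.14 (3) excludes `3 ∣ #μ(H_K)`; Rubin 1991
excludes `p ∣ #𝒪_K^×`); the descent (D′) is duality bookkeeping (Poitou–Tate + Greenberg's Lemma 4.2),
provable in principle, not formalised. Typed as an INPUT; nothing booked.
[cite: PollackWeston2011, Remark 3.1, Lemma 3.4 and Prop. 3.7 (arXiv:math/0610694 pp. 7–8: the minimal and the Greenberg Selmer group differ by μ = Σ Tamagawa exponents at the primes inert in K, and so do their values at the trivial character) (shape only: the local algebra, printed in the modular-form setting)]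
[cite: Harari2020, Thm. 17.13 (the Poitou–Tate nine-term sequence)]
[cite: GreenbergLNM1716, §3 Lemmas 3.1–3.4 and §4 Lemma 4.2 (local kernels; Euler characteristic at T = 0)]
[cite: BurungaleKobayashiNakamuraOta2026, §3.2.2, Prop. 3.7 and Thm. 3.14 (arXiv:2608.06879 pp. 19–20, 24) (claim; preprint; shape only)] -/
@[conjecture] def RamifiedCMEllipticUnitIMCAtZpThreeGr : Prop :=
  ∀ (K : Type) [Field K] [NumberField K] (𝔭 : HeightOneSpectrum (𝓞 K))
    (W' : WeierstrassCurve ℚ) [W'.IsElliptic] [W'.IsGloballyMinimal] (C : VariableChange ℚ),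
    IsFrameThree W K 𝔭 W' C → W.analyticRank = 1 →
    ∀ (κ : ZpExtension K 3), κ.IsAnticyclotomic →
      ∀ (γ : absoluteGaloisGroup K) [Fact (κ.IsTopGenerator γ)],
        ∃ (ι : PadicAlgCl 3 ≃+* ℂ) (φ : HeckeCharacter K) (Ω : ℂ) (𝓔 : AcDualExpSystem W 3 K 𝔭 κ ι)
          (D : EllipticUnitClassData W 3 K 𝔭 κ γ ι φ Ω 𝓔) (c : ℕ),
          Ω ≠ 0 ∧ (∀ s : ℂ, 3 / 2 < s.re → heckeLFunction φ s = W.LSeries s) ∧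
          D.HasBottomIndexExpZp c ∧
          (Finite (localKer κ.kerSubgroup ((W.baseChange K).geomPrimaryTorsion 3) 𝔭) →
            ∀ (T₀ : Finset (HeightOneSpectrum (𝓞 K))), (∀ v ∈ T₀, ((3 : ℕ) : 𝓞 K) ∉ v.asIdeal) →
            (∀ v : HeightOneSpectrum (𝓞 K), v ∉ T₀ → ((3 : ℕ) : 𝓞 K) ∉ v.asIdeal →
              v.asIdeal.ramificationIdx (𝓞 ℚ) = 1 → v.asIdeal.inertiaDeg (𝓞 ℚ) = 1 →
              (W.baseChange K).HasGoodReductionAt v ∨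
                ∀ R : ((W.baseChange K).baseChange (v.adicCompletion K)).toAffine.Point,
                  (3 : ℕ) • R = 0 → R = 0) →
            ∀ (n₀ : ℕ), AcSelmer.XAc.HasCharValuationAt (W.baseChange K) 3 κ 𝔭 ∅ γ n₀ →
              Finite {x : AcSelmer.XAc (W.baseChange K) 3 κ 𝔭 ∅ γ //
                (PowerSeries.X : IwasawaAlgebra 3) • x = 0} →
              (c : ℤ) + padicValNat 3 (globalControlDefectAtThree W K κ) +
                  padicValNat 3 (controlDefectAtThree W K 𝔭 κ T₀) =
                (n₀ : ℤ) + padicValNat 3 (Nat.card {x : AcSelmer.XAc (W.baseChange K) 3 κ 𝔭 ∅ γ //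
                    (PowerSeries.X : IwasawaAlgebra 3) • x = 0}) +
                  padicValNat 3 (localKernelProductAtThree W 𝔭 κ T₀) +
                  padicValNat 3 (inertTamagawaProductThree W K))

/-- **(PR|IMC)₃♮ TYPED (NOT in print; nothing asserted): Perrin-Riou's law for the bottom elliptic-unit
class at the ramified prime `3` in analytic rank one, RELATIVE to the (IMC)₃♮ identity, with the
COMPLETE defect display.** Binders = those of (R-EU)₃ᵀ (`RamifiedCMEllipticUnitIndexAtThreeT`,
p563046) VERBATIM — frame, `r_an(W) = 1`, anticyclotomic `κ` with generator `γ`, generators `P, P'`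
modulo torsion with exact `3`-divisibility levels `ñ, ñ'` in `W(ℚ₃)`, `W'(ℚ₃)` MODULO TORSION,
finiteness of `ker r_𝔭`, a finite `T₀` of places `v ∤ 3` with (Av)₃ off `T₀`, `#Ш_an(W) = q`,
`#Ш_an(W') = q'` —; then for EVERY pinned datum `D` and every `c` with `D.HasBottomIndexExpZp c`
satisfying the (IMC)₃♮ identity at `T₀`:
  `c + 2 log₃ d₀ = ñ + ñ' + ord₃ q + ord₃ q' + log₃ τ(T₀) + t_cs`,
i.e. `3^c · #W(K)[3^∞]² = 3^{ñ+ñ'} · #Ш_an(W)_3 #Ш_an(W')_3 · #ker r_𝔭 · ∏_{v ∈ T₀} #ker r_v ·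
3^{t_cs}` — a Birch–Swinnerton-Dyer-over-`K`-shaped value of the elliptic-unit index with the torsion
square, the local kernel at `𝔭` and EVERY Tamagawa number of `W_K` away from `3` (finitely decomposed
places through `τ(T₀)`, completely split = inert places through `t_cs`). What a `3`-adic Gross–Zagier /
explicit reciprocity law at the additive prime `3` would prove; none is in print ([BKNO] §1.4, their
Thm. 7.2 is `p ≥ 5`; [PR93] §3.3.4–3.3.5 is the conjectural shape). The gen-3 carrier
`RamifiedCMBottomClassIndexLawAtZpThreeT` (p570438) is «`c + log₃ d₀ = … + log₃ d(T₀)`», which differs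
from this one by `log₃ (τ(T₀) · 3^{t_cs} / (d₀ · d(T₀)))`. LABEL: CONSTRUCTION / OPEN. In the kernel
(this file): with (IMC)₃♮ it gives (R-EU)₃ᵀ, and (R-EU)₃ᵀ with (R-tors)₃ᵀ gives it back.
[cite: PerrinRiou1993AIF, §3.3.4–3.3.5 (pp. 976–977: the conjectural leading-term formula)]
[cite: BurungaleKobayashiNakamuraOta2026, Thm. 7.2 and §1.4 (arXiv:2608.06879 pp. 8, 41) (claim; preprint; shape only)]
[cite: PollackWeston2011, Prop. 3.7 (arXiv:math/0610694 p. 8: the Tamagawa exponents at the trivial character) (shape only)]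
[cite: GreenbergLNM1716, §3 Lemmas 3.1–3.4 and §4 Prop. 4.13 (the local kernels and the defects)]
[cite: GrossZagier1986, Thm. I.(7.3) (rationality of #Ш_an)] -/
@[conjecture] def RamifiedCMBottomClassIndexLawAtZpThreeGr : Prop :=
  ∀ (K : Type) [Field K] [NumberField K] (𝔭 : HeightOneSpectrum (𝓞 K))
    (W' : WeierstrassCurve ℚ) [W'.IsElliptic] [W'.IsGloballyMinimal] (C : VariableChange ℚ),
    IsFrameThree W K 𝔭 W' C → W.analyticRank = 1 →
    ∀ (κ : ZpExtension K 3), κ.IsAnticyclotomic →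
      ∀ (γ : absoluteGaloisGroup K) [Fact (κ.IsTopGenerator γ)]
        (P : W.toAffine.Point) (n : ℕ) (P' : W'.toAffine.Point) (n' : ℕ),
        ¬ IsOfFinAddOrder P →
        (∀ R : W.toAffine.Point, ∃ (k : ℤ) (T : W.toAffine.Point), IsOfFinAddOrder T ∧ R = k • P + T) →
        (∃ Q T : (W.baseChange ℚ_[3]).toAffine.Point, IsOfFinAddOrder T ∧
          (3 : ℕ) ^ n • Q = W.toPadicPoint 3 P + T) →
        (∀ Q T : (W.baseChange ℚ_[3]).toAffine.Point, IsOfFinAddOrder T →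
          (3 : ℕ) ^ (n + 1) • Q ≠ W.toPadicPoint 3 P + T) →
        ¬ IsOfFinAddOrder P' →
        (∀ R : W'.toAffine.Point, ∃ (k : ℤ) (T : W'.toAffine.Point),
          IsOfFinAddOrder T ∧ R = k • P' + T) →
        (∃ Q T : (W'.baseChange ℚ_[3]).toAffine.Point, IsOfFinAddOrder T ∧
          (3 : ℕ) ^ n' • Q = W'.toPadicPoint 3 P' + T) →
        (∀ Q T : (W'.baseChange ℚ_[3]).toAffine.Point, IsOfFinAddOrder T →
          (3 : ℕ) ^ (n' + 1) • Q ≠ W'.toPadicPoint 3 P' + T) →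
        Finite (localKer κ.kerSubgroup ((W.baseChange K).geomPrimaryTorsion 3) 𝔭) →
        ∀ (T₀ : Finset (HeightOneSpectrum (𝓞 K))), (∀ v ∈ T₀, ((3 : ℕ) : 𝓞 K) ∉ v.asIdeal) →
        (∀ v : HeightOneSpectrum (𝓞 K), v ∉ T₀ → ((3 : ℕ) : 𝓞 K) ∉ v.asIdeal →
          v.asIdeal.ramificationIdx (𝓞 ℚ) = 1 → v.asIdeal.inertiaDeg (𝓞 ℚ) = 1 →
          (W.baseChange K).HasGoodReductionAt v ∨
            ∀ R : ((W.baseChange K).baseChange (v.adicCompletion K)).toAffine.Point,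
              (3 : ℕ) • R = 0 → R = 0) →
        ∀ (q q' : ℚ), shaAn W = (q : ℂ) → shaAn W' = (q' : ℂ) →
        ∀ (ι : PadicAlgCl 3 ≃+* ℂ) (φ : HeckeCharacter K) (Ω : ℂ) (𝓔 : AcDualExpSystem W 3 K 𝔭 κ ι)
          (D : EllipticUnitClassData W 3 K 𝔭 κ γ ι φ Ω 𝓔) (c : ℕ),
          Ω ≠ 0 → (∀ s : ℂ, 3 / 2 < s.re → heckeLFunction φ s = W.LSeries s) →
          D.HasBottomIndexExpZp c →
          (∀ (n₀ : ℕ), AcSelmer.XAc.HasCharValuationAt (W.baseChange K) 3 κ 𝔭 ∅ γ n₀ →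
            Finite {x : AcSelmer.XAc (W.baseChange K) 3 κ 𝔭 ∅ γ //
              (PowerSeries.X : IwasawaAlgebra 3) • x = 0} →
            (c : ℤ) + padicValNat 3 (globalControlDefectAtThree W K κ) +
                padicValNat 3 (controlDefectAtThree W K 𝔭 κ T₀) =
              (n₀ : ℤ) + padicValNat 3 (Nat.card {x : AcSelmer.XAc (W.baseChange K) 3 κ 𝔭 ∅ γ //
                  (PowerSeries.X : IwasawaAlgebra 3) • x = 0}) +
                padicValNat 3 (localKernelProductAtThree W 𝔭 κ T₀) +
                padicValNat 3 (inertTamagawaProductThree W K)) →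
          (c : ℤ) + 2 * padicValNat 3 (globalControlDefectAtThree W K κ) =
            (n : ℤ) + n' + padicValRat 3 q + padicValRat 3 q' +
              padicValNat 3 (localKernelProductAtThree W 𝔭 κ T₀) +
              padicValNat 3 (inertTamagawaProductThree W K)

end CarriersGr

/-! ## §2 PROVED seams: the ♮ pair ⟹ (R-EU)₃ᵀ; (R-EU)₃ᵀ ∧ (R-tors)₃ᵀ ⟹ (PR|IMC)₃♮ -/

section SeamsGr

variable {W}

omit [W.IsGloballyMinimal] in
/-- **(IMC)₃♮ ∧ (PR|IMC)₃♮ ⟹ (R-EU)₃ᵀ** (PROVED; all three regimes): take the pinned datum and `c`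
from the IMC piece, read «`c + log₃ d₀ + log₃ d(T₀) = n₀ + log₃ #X[T] + log₃ τ(T₀) + t_cs`» and
«`c + 2 log₃ d₀ = ñ + ñ' + ord₃ q + ord₃ q' + log₃ τ(T₀) + t_cs`», subtract: the displayed `τ(T₀)` and
`t_cs` cancel and «`n₀ + log₃ #X[T] + log₃ d₀ = ñ + ñ' + ord₃ q + ord₃ q' + log₃ d(T₀)`» remains.
[cite: Miller2011LMS, Def. 1.1] [cite: GreenbergLNM1716, §4 Prop. 4.13 (the defect terms)] -/
theorem ramifiedCMEllipticUnitIndexAtThreeT_of_imcGr_of_indexLawGr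
    (h1 : RamifiedCMEllipticUnitIMCAtZpThreeGr W) (h2 : RamifiedCMBottomClassIndexLawAtZpThreeGr W) :
    RamifiedCMEllipticUnitIndexAtThreeT W := by
  intro K _ _ 𝔭 W' _ _ C hF hr κ hκ γ _ P n P' n' hP hgen hdiv hndiv hP' hgen' hdiv' hndiv' hfin𝔭
    T₀ hT₀ hv q q' hq hq' n₀ hn₀ hfin
  obtain ⟨ι, φ, Ω, 𝓔, D, c, hΩ, hφ, hc, himc⟩ := h1 K 𝔭 W' C hF hr κ hκ γ
  have e1 := himc hfin𝔭 T₀ hT₀ hv n₀ hn₀ hfin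
  have e2 := h2 K 𝔭 W' C hF hr κ hκ γ P n P' n' hP hgen hdiv hndiv hP' hgen' hdiv' hndiv' hfin𝔭
    T₀ hT₀ hv q q' hq hq' ι φ Ω 𝓔 D c hΩ hφ hc (himc hfin𝔭 T₀ hT₀ hv)
  linarith

omit [W.IsGloballyMinimal] in
/-- **(R-EU)₃ᵀ ∧ (R-tors)₃ᵀ ⟹ (PR|IMC)₃♮** (PROVED; the converse seam): (R-tors)₃ᵀ supplies `n₀` and
the finiteness of `X[T]`, the (IMC)₃♮ hypothesis gives the complete dictionary for `c`, (R-EU)₃ᵀ the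
defect-corrected value; add. [cite: Miller2011LMS, Def. 1.1] -/
theorem ramifiedCMBottomClassIndexLawAtZpThreeGr_of_indexAtThreeT
    (h3 : RamifiedCMEllipticUnitIndexAtThreeT W) (ht : RamifiedCMStrictTorsionAtThreeT W) :
    RamifiedCMBottomClassIndexLawAtZpThreeGr W := by
  intro K _ _ 𝔭 W' _ _ C hF hr κ hκ γ _ P n P' n' hP hgen hdiv hndiv hP' hgen' hdiv' hndiv' hfin𝔭
    T₀ hT₀ hv q q' hq hq' ι φ Ω 𝓔 D c _hΩ _hφ _hc himc
  obtain ⟨⟨n₀, hn₀⟩, hfin⟩ := ht K 𝔭 W' C hF hr κ hκ γ hfin𝔭 T₀ hT₀ hv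
  have e1 := himc n₀ hn₀ hfin
  have e3 := h3 K 𝔭 W' C hF hr κ hκ γ P n P' n' hP hgen hdiv hndiv hP' hgen' hdiv' hndiv' hfin𝔭
    T₀ hT₀ hv q q' hq hq' n₀ hn₀ hfin
  linarith

omit [W.IsGloballyMinimal] in
/-- **(R-EU)₃ᵀ ⟹ (PR|IMC)₃♮, granted GZK** (PROVED): the converse seam with (R-tors)₃ᵀ discharged by
`ramifiedCMStrictTorsionAtThreeT_of_GZK`. [cite: Kolyvagin1990, Thm. A] [cite: Miller2011LMS, Def. 1.1] -/
theorem ramifiedCMBottomClassIndexLawAtZpThreeGr_of_indexAtThreeT_of_GZK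
    (hGZK : rank_eq_analyticRank_of_analyticRank_le_one)
    (h3 : RamifiedCMEllipticUnitIndexAtThreeT W) : RamifiedCMBottomClassIndexLawAtZpThreeGr W :=
  ramifiedCMBottomClassIndexLawAtZpThreeGr_of_indexAtThreeT h3
    (ramifiedCMStrictTorsionAtThreeT_of_GZK W hGZK)

omit [W.IsGloballyMinimal] in
/-- **Modulo GZK, the pair {(IMC)₃♮, (PR|IMC)₃♮} recovers (R-EU)₃ᵀ and (R-EU)₃ᵀ recovers the relative
law.** [cite: Miller2011LMS, Def. 1.1] -/
theorem ramifiedCMBottomClassIndexLawAtZpThreeGr_iff_indexAtThreeT_of_imcGr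
    (hGZK : rank_eq_analyticRank_of_analyticRank_le_one) (h1 : RamifiedCMEllipticUnitIMCAtZpThreeGr W) :
    RamifiedCMBottomClassIndexLawAtZpThreeGr W ↔ RamifiedCMEllipticUnitIndexAtThreeT W :=
  ⟨fun h2 => ramifiedCMEllipticUnitIndexAtThreeT_of_imcGr_of_indexLawGr h1 h2,
    fun h3 => ramifiedCMBottomClassIndexLawAtZpThreeGr_of_indexAtThreeT_of_GZK hGZK h3⟩

end SeamsGr

/-! ## §3 PROVED consumer: the ♮ pair + local finiteness + four named facts ⟹ `BSD(W, 3)` at any frame -/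

section ConsumerGr

variable {W}
variable {K : Type} [Field K] [NumberField K] {𝔭 : HeightOneSpectrum (𝓞 K)}
  {W' : WeierstrassCurve ℚ} [W'.IsElliptic] [W'.IsGloballyMinimal] {C : VariableChange ℚ}

/-- **`BSD(W, 3)` at ANY analytic-rank-one `3`-frame (regimes N ∪ V ∪ T) from (IMC)₃♮ ∧ (PR|IMC)₃♮ + the
local-kernel finiteness obligation + four named facts** — companion VII-c's
`bsdp_three_of_indexLawAtThreeT_of_isFrameThree` fed with the seam of §2. CONDITIONAL on the three typed
inputs; nothing booked. [cite: Miller2011LMS, §1 and Def. 1.1 (arXiv:1010.2431 p. 3)] [cite: GrossZagier1986, Thm. I.(7.3)] -/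
theorem bsdp_three_of_imcGr_of_indexLawGr_of_isFrameThree (hmod : hasEntireLFunction_rat)
    (hGZ : GrossZagier1986_thm_I_7_3) (hGZK : rank_eq_analyticRank_of_analyticRank_le_one)
    (hCassels : bsdRHS_eq_of_isIsogenous) (hF : IsFrameThree W K 𝔭 W' C) (hr : W.analyticRank = 1)
    (hfin : LocalKernelFiniteAtThree W) (h1 : RamifiedCMEllipticUnitIMCAtZpThreeGr W)
    (h2 : RamifiedCMBottomClassIndexLawAtZpThreeGr W) : BSDp W 3 :=
  bsdp_three_of_indexLawAtThreeT_of_isFrameThree hmod hGZ hGZK hCassels hF hr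
    (fun κ hκ => hfin K 𝔭 W' C hF κ hκ)
    (ramifiedCMEllipticUnitIndexAtThreeT_of_imcGr_of_indexLawGr h1 h2)

omit [W'.IsGloballyMinimal] in
/-- **Class-wide form: (∀ W, (IMC)₃♮) ∧ (GZK → ∀ W, (PR|IMC)₃♮) ⟹ (GZK → ∀ W, (R-EU)₃ᵀ)** — the shape the
route-level edges consume (`PrintCfram.localThreeTorsionBSDThree_of_indexLawAtThreeT` and its N / V / C1
siblings). [cite: Miller2011LMS, Def. 1.1] -/
theorem forall_indexAtThreeT_of_forall_imcGr_of_forall_indexLawGr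
    (h1 : ∀ (W : WeierstrassCurve ℚ) [W.IsElliptic] [W.IsGloballyMinimal],
      W.HasCM → CMRamified W 3 → W.analyticRank = 1 → RamifiedCMEllipticUnitIMCAtZpThreeGr W)
    (h2 : rank_eq_analyticRank_of_analyticRank_le_one →
      ∀ (W : WeierstrassCurve ℚ) [W.IsElliptic] [W.IsGloballyMinimal],
      W.HasCM → CMRamified W 3 → W.analyticRank = 1 → RamifiedCMBottomClassIndexLawAtZpThreeGr W)
    (hGZK : rank_eq_analyticRank_of_analyticRank_le_one) :
    ∀ (W : WeierstrassCurve ℚ) [W.IsElliptic] [W.IsGloballyMinimal],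
      W.HasCM → W.analyticRank = 1 → CMRamified W 3 → RamifiedCMEllipticUnitIndexAtThreeT W :=
  fun W _ _ hCM hr hram =>
    ramifiedCMEllipticUnitIndexAtThreeT_of_imcGr_of_indexLawGr (h1 W hCM hram hr) (h2 hGZK W hCM hram hr)

end ConsumerGr

end Summit.BirchSwinnertonDyer.Rank1Residual.X12.O11

end
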